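import Mathlib.LinearAlgebra.CrossProduct
import Mathlib.Analysis.SpecificLimits.Basic
import Literature.Probability.LatticeModels.RandomCurrents
import Literature.MathematicalPhysics.QuantumLattice.SpinOperators
import HarnessLib

/-!
# The `SU(2)`-decorated random-current two-point observable

Topic `Literature/Probability/LatticeModels`, namespace `Literature.Probability.LatticeModels`
(dot-notation extensions in `….Current`). Definition request `defn-DecoratedCurrentObservable` of
route `DiracCensus` (summit CriticalPhenomena, sub-problem Ising3DConformalLimit, card
`dirac-census-algebraic-betac`, item `SpinorIdentityExists`): the three-dimensional analogue of
Smirnov's fermionic observable in which the winding phase `exp(-i W/2)` of the planar theory is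
replaced by the spin-½ (`SU(2)`) holonomy of the backbone of a current.

## Contents

For a finite simple graph `G` on `V` (a piece of `ℤ³`, or any graph *drawn* in `ℤ³` by a position
map `pos : V → Site 3`), a current `n : Current G` (`RandomCurrents.lean`), a source `a` and a
probe `z`:

* `Current.bond n e` — `n` read on an unordered pair (`0` off the edge set); `Current.size n = |n|`.
* `Current.backbone rank n a z : List V` — the **canonically resolved backbone** of `n` from `a`
  towards `z`: the vertex list of the deterministic exploration which, from the current position,
  traverses the *unused* bond of *odd* current whose far end has least local rank
  `rank pos w : ℕ`, and halts on reaching `z` (or when no such bond is left). This is Aizenman's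
  walk (Aizenman 1982, §9, rules (i)–(iv), p. 23: "any nonrepeating path along bonds with odd
  values of `n` which starts at `x`, eventually reaches `y` … the walk stops upon the first hit of
  `y`") restricted to the odd bonds, with the ordering of bonds supplied by the *local* ranking
  `rank` (cf. Duminil-Copin 2016, §2.3.1: the backbone is canonical once orderings are fixed).
  Implementation: `trailEdges`, `oddExits`, `trailStep`, `trailRun`, `backboneState`,
  `backboneEnd`.
* `dirCode`, `latticeRank pos` — the splitting rule used on `ℤ^d`: the neighbour `y` of `x` is
  ranked by the code of the lattice direction `pos y - pos x`, `+e₀ < -e₀ < +e₁ < -e₁ < …`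
  (translation invariant and local).
* `pauliVec`, `spinTurn u v`, `holonomy` — the spin-½ lift `(1/√2)(1 - i (u × v)·σ)` of the
  quarter turn taking a lattice direction `u` to a perpendicular one `v` (identity for `v = u`,
  and, by convention, for the reversal `v = -u`, which never occurs along a trail), and the ordered
  product of the turn factors of consecutive steps of a lattice word; `steps` turns a list of
  lattice points into its word of increments; `Current.hol pos n a z = Hol(γ(n))`.
* `currentSizeSum G t A = ∑_{∂n = A} t^{|n|}`, `decoratedCurrentSum G pos t a z =
  ∑_{∂n = {a} ∆ {z}} t^{|n|} Hol(γ(n))` and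
  **`decoratedCurrentObservable G pos t a z = F_t(a; z) = (∑_{∂n = ∅} t^{|n|})⁻¹ ∑_{∂n = {a} ∆ {z}} t^{|n|} Hol(γ(n)) ∈ M₂(ℂ)`**.

## Main statements

* `Current.backboneEnd_eq_of_sources_eq` (**Aizenman's observation**, 1982, §9, p. 23): if
  `∂n = {a} ∆ {z}` the canonical backbone ends at `z`; with `Current.head?_backbone` (it starts at
  `a`), `Current.isChain_backbone` / `Current.isChain_adj_backbone` (consecutive vertices are joined
  by bonds of odd current, in particular it is a walk in `G`), `Current.odd_bond_of_mem_trailEdges`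
  and `Current.card_trailEdges_backboneState` (its bonds are pairwise distinct: a trail).
* `Current.degree_mod_two`: `deg_n(p) ≡ #{odd bonds at p} (mod 2)`.
* `summable_currentSizeSum_term`, `currentSizeSum_empty_pos`: for `|t| < 1` the generating sums
  converge absolutely and the normaliser `∑_{∂n = ∅} t^{|n|} ≥ 1 > 0` (the zero current), so the
  observable is not a junk value there.
* `holonomy_replicate`: a straight word has trivial holonomy; `pauliVec_mul_self`
  (`(w·σ)² = |w|²`), `spinTurn_mem_unitaryGroup_of_perp` (the turn factor of perpendicular unit
  lattice directions is unitary).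

## Design choices

* **Generality.** The route's census (its request `LocalIdentityMatrix`) quantifies over "every
  graph locally isomorphic to `ℤ³`", so the observable takes an arbitrary finite graph with a
  position map `pos : V → Site 3` rather than only `Λ ⊆ ℤ³`; for `Λ : Finset (Site 3)` take
  `G = (zdGraph 3).induce ↑Λ` and `pos = Subtype.val`.
* **Weights.** As requested, `t^{|n|}` summed over all `ℕ`-valued currents (`t = tanh β`); since
  `Hol(γ(n))` only depends on the parity pattern of `n`, summing out the even parts multiplies
  numerator and denominator by the same factor `(1 - t²)^{-|E|}`, so `F_t` equals the
  high-temperature-graph ratio `∑_{∂η = {a,z}} t^{|η|} Hol(γ(η)) / ∑_{∂η = ∅} t^{|η|}` over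
  `{0,1}`-valued `η`; with the weights `β^{n}/n!` of `Current.weight` one gets the same ratio at
  `t = tanh β` (factor `cosh β ^ |E|`). Neither identity is stated here.
* **Splitting rule.** The exploration ("least unused odd bond, first hit of `z`") is the rule the
  request names; a pairing-based resolution (as in the planar non-crossing convention) would be a
  different canonical backbone. The rule and the reversal convention are part of the definition.
* **Order of the product.** `Hol = h(d₀,d₁) h(d₁,d₂) ⋯` with the first turn leftmost.
* **Junk values.** `dirCode` is `0` on non-unit vectors; `spinTurn` is meaningful on unit lattice
  vectors; the `tsum`s are `0` when not summable (never the case for `|t| < 1` on a finite graph: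
  `currentSizeSum` is treated here, the matrix-valued sum is bounded termwise by it times the
  finitely many values of `Hol`); for `a = z` the source constraint is `∂n = ∅` and the backbone is
  `[a]`.

## What is not here

The planar sanity statement (on `ℤ²` with `U(1)` phases this is the spin fermionic observable of
Smirnov 2010 / Chelkak–Smirnov 2012, Thm. 1.2), the infinite-volume limit `Λ ↑ ℤ³`, unitarity of
the holonomy of a whole backbone and membership of the turn factors in the binary octahedral
group (only unitarity of a single turn factor is proved, `spinTurn_mem_unitaryGroup_of_perp`),
locality / translation covariance of the backbone, and any identity satisfied by `F_t`: all are
left to the route. This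
is a posited object of a route; nothing is claimed about it beyond the bookkeeping lemmas below.

## References

* M. Aizenman, *Geometric analysis of φ⁴ fields and Ising models*, Comm. Math. Phys. 86 (1982)
  1–48, §9 (random-walk representation, rules (i)–(iv), p. 23) [AizenmanCMP1982].
* H. Duminil-Copin, *Random currents expansion of the Ising model*, arXiv:1607.06933, §2.3.1
  (backbone of a current via fixed orderings) [DuminilCopin2016].
* S. Smirnov, *Conformal invariance in random cluster models I*, Ann. Math. 172 (2010), §2;
  D. Chelkak, S. Smirnov, Invent. Math. 189 (2012), Thm. 1.2 (planar fermionic observables).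
* H. Tasaki, *Physics and Mathematics of Quantum Many-Body Systems* (2020), §2.1,
  eqs. (2.1.8)–(2.1.10) (Pauli matrices, spin rotation operators) [Tasaki2020].
-/

noncomputable section

open Finset Matrix
open scoped symmDiff

namespace Literature.Probability.LatticeModels

variable {V : Type*} [Fintype V] {G : SimpleGraph V} [DecidableRel G.Adj]

namespace Current

/-! ### The size of a current -/

/-- The size `|n| = ∑_e n_e` of a current (the exponent of `t = tanh β` in the
high-temperature weight `t^{|n|}`). [folklore] -/
def size (n : Current G) : ℕ := ∑ e, n e

/-- The zero current has size `0`. [folklore] -/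
@[simp] theorem size_zero : (0 : Current G).size = 0 := by simp [size]

/-- `t^{|n|} = ∏_e t^{n_e}`. [folklore] -/
theorem pow_size (t : ℝ) (n : Current G) : t ^ n.size = ∏ e, t ^ n e :=
  (Finset.prod_pow_eq_pow_sum univ n t).symm

variable [DecidableEq V]

/-! ### Bonds -/

/-- The current read on an unordered pair: `n_e` for an edge `e` of `G`, and `0` for a pair
that is not an edge. [folklore] -/
def bond (n : Current G) (e : Sym2 V) : ℕ :=
  if h : e ∈ G.edgeFinset then n ⟨e, h⟩ else 0

/-- On an edge of `G`, `bond` is the current. [folklore] -/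
@[simp] theorem bond_coe (n : Current G) (e : G.edgeFinset) : n.bond e = n e := by
  unfold bond; rw [dif_pos e.2]

/-- Off the edge set, `bond` vanishes. [folklore] -/
theorem bond_of_not_mem (n : Current G) {e : Sym2 V} (h : e ∉ G.edgeFinset) : n.bond e = 0 := by
  unfold bond; rw [dif_neg h]

/-- The zero current vanishes on every pair. [folklore] -/
@[simp] theorem bond_zero (e : Sym2 V) : (0 : Current G).bond e = 0 := by
  unfold bond; split_ifs <;> rfl

/-- A pair carrying a non-zero current is an edge of `G`. [folklore] -/
theorem mem_edgeFinset_of_bond_ne_zero (n : Current G) {e : Sym2 V} (h : n.bond e ≠ 0) :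
    e ∈ G.edgeFinset := by
  by_contra he
  exact h (n.bond_of_not_mem he)

/-- A pair carrying a non-zero current is an edge: its ends are adjacent. [folklore] -/
theorem adj_of_bond_ne_zero (n : Current G) {x y : V} (h : n.bond s(x, y) ≠ 0) : G.Adj x y := by
  have := n.mem_edgeFinset_of_bond_ne_zero h
  rwa [SimpleGraph.mem_edgeFinset, SimpleGraph.mem_edgeSet] at this

/-- The bonds of odd current at the vertex `p`. [folklore] -/
def oddBondsAt (n : Current G) (p : V) : Finset (Sym2 V) :=
  univ.filter fun e => p ∈ e ∧ Odd (n.bond e)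

/-- The `n`-degree as a sum of `bond` over all unordered pairs containing `p`. [folklore] -/
theorem degree_eq_sum_bond (n : Current G) (p : V) :
    n.degree p = ∑ e : Sym2 V, if p ∈ e then n.bond e else 0 := by
  unfold degree
  have h1 : (∑ e : G.edgeFinset, if p ∈ (e : Sym2 V) then n e else 0)
      = ∑ e ∈ G.edgeFinset, if p ∈ e then n.bond e else 0 := by
    rw [← Finset.sum_coe_sort G.edgeFinset]
    refine Finset.sum_congr rfl fun e _ => ?_
    rw [bond_coe]
  rw [h1]
  refine Finset.sum_subset (subset_univ _) fun e _ he => ?_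
  rw [n.bond_of_not_mem he]
  simp

/-- **Degree parity**: `deg_n(p) ≡ #{e ∋ p : n_e odd} (mod 2)`; in particular `p` is a source of
`n` iff an odd number of bonds at `p` carry an odd current. [folklore] -/
theorem degree_mod_two (n : Current G) (p : V) : n.degree p % 2 = #(n.oddBondsAt p) % 2 := by
  rw [degree_eq_sum_bond, oddBondsAt, Finset.card_filter, Finset.sum_nat_mod,
    Finset.sum_nat_mod (f := fun e => if p ∈ e ∧ Odd (n.bond e) then 1 else 0)]
  congr 1
  refine Finset.sum_congr rfl fun e _ => ?_
  by_cases hpe : p ∈ e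
  · by_cases ho : Odd (n.bond e)
    · simp [hpe, ho, Nat.odd_iff.1 ho]
    · simp [hpe, ho, Nat.even_iff.1 (Nat.not_odd_iff_even.1 ho)]
  · simp [hpe]

/-- Sources in terms of odd bonds: `p ∈ ∂n ↔ #{odd bonds at p}` is odd. [folklore] -/
theorem mem_sources_iff_odd_card_oddBondsAt (n : Current G) (p : V) :
    p ∈ n.sources ↔ Odd #(n.oddBondsAt p) := by
  rw [mem_sources_iff, Nat.odd_iff, Nat.odd_iff, degree_mod_two]

/-! ### The canonical backbone trail -/

/-- The bonds along a reversed vertex list: `trailEdges p [q₁, q₂, …] = {p q₁, q₁ q₂, …}`. [folklore] -/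
def trailEdges : V → List V → Finset (Sym2 V)
  | _, [] => ∅
  | p, q :: l => insert s(p, q) (trailEdges q l)

omit [Fintype V] [DecidableRel G.Adj] in
/-- Unfolding of `trailEdges` on the empty list. [folklore] -/
@[simp] theorem trailEdges_nil (p : V) : trailEdges p [] = ∅ := rfl

omit [Fintype V] [DecidableRel G.Adj] in
/-- Unfolding of `trailEdges` on a cons. [folklore] -/
@[simp] theorem trailEdges_cons (p q : V) (l : List V) :
    trailEdges p (q :: l) = insert s(p, q) (trailEdges q l) := rfl

/-- The admissible exits of the exploration in state `s = (position, earlier vertices)` with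
target `z`: none once the target is reached; otherwise the far ends of the *unused* bonds at the
position carrying an *odd* current (Aizenman 1982, §9 (ii)–(iv), odd bonds only). [cite: AizenmanCMP1982, §9 (ii)-(iv), p. 23] -/
def oddExits (n : Current G) (z : V) (s : V × List V) : Finset V :=
  if s.1 = z then ∅
  else univ.filter fun w => Odd (n.bond s(s.1, w)) ∧ s(s.1, w) ∉ trailEdges s.1 s.2

/-- Membership in `oddExits`. [folklore] -/
theorem mem_oddExits {n : Current G} {z : V} {s : V × List V} {w : V} :
    w ∈ n.oddExits z s ↔ s.1 ≠ z ∧ Odd (n.bond s(s.1, w)) ∧ s(s.1, w) ∉ trailEdges s.1 s.2 := by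
  unfold oddExits
  split_ifs with h
  · simp [h]
  · simp [h]

/-- An admissible exit is a genuine move: it differs from the position. [folklore] -/
theorem ne_of_mem_oddExits {n : Current G} {z : V} {s : V × List V} {w : V}
    (hw : w ∈ n.oddExits z s) : s.1 ≠ w := by
  have hodd := (mem_oddExits.1 hw).2.1
  exact (n.adj_of_bond_ne_zero fun h0 => by simp [h0] at hodd).ne

/-- At the target there is no admissible exit. [folklore] -/
theorem oddExits_of_eq {n : Current G} {z : V} {s : V × List V} (h : s.1 = z) :
    n.oddExits z s = ∅ := by
  unfold oddExits; rw [if_pos h]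

/-- The zero current has no admissible exit. [folklore] -/
@[simp] theorem oddExits_zero (z : V) (s : V × List V) : (0 : Current G).oddExits z s = ∅ := by
  ext w; simp [mem_oddExits]

variable (rank : V → V → ℕ)

/-- One step of the exploration: if some exit is admissible, traverse the bond to the admissible
exit `w` of least rank `rank pos w`; otherwise stay (Aizenman 1982, §9 (ii)–(iv), with the fixed
local ordering of bonds as the tie-breaking rule). [cite: AizenmanCMP1982, §9 (ii)-(iv), p. 23] -/
def trailStep (n : Current G) (z : V) (s : V × List V) : V × List V :=
  if h : (n.oddExits z s).Nonempty then
    (Function.argminOn (rank s.1) (↑(n.oddExits z s) : Set V) h, s.1 :: s.2)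
  else s

/-- The state of the exploration started at `a` (towards `z`) after `k` steps. [folklore] -/
def trailRun (n : Current G) (a z : V) (k : ℕ) : V × List V :=
  (n.trailStep rank z)^[k] (a, [])

/-- The final state of the exploration: `|E| + 1` steps suffice, since every productive step uses
a new bond (`Current.not_nonempty_oddExits_backboneState`). [folklore] -/
def backboneState (n : Current G) (a z : V) : V × List V :=
  n.trailRun rank a z (#G.edgeFinset + 1)

/-- **The canonically resolved backbone** `γ(n)` of the current `n` from `a` towards `z`, as the
list of its vertices in path order: starting at `a`, repeatedly traverse the unused bond of odd
current of least local rank at the current position, until `z` is reached or no such bond remains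
(Aizenman 1982, §9, p. 23, restricted to odd bonds; Duminil-Copin 2016, §2.3.1 for the rôle of the
fixed ordering). [cite: AizenmanCMP1982, §9 (i)-(iv), p. 23] -/
def backbone (n : Current G) (a z : V) : List V :=
  ((n.backboneState rank a z).1 :: (n.backboneState rank a z).2).reverse

/-- The endpoint of the canonical backbone. [folklore] -/
def backboneEnd (n : Current G) (a z : V) : V := (n.backboneState rank a z).1

section BackboneProofs

variable {rank} {n : Current G} {a z : V}

/-- A halted state is fixed by the step. [folklore] -/
theorem trailStep_of_not {s : V × List V} (h : ¬(n.oddExits z s).Nonempty) :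
    n.trailStep rank z s = s := by
  unfold trailStep; rw [dif_neg h]

/-- A live state moves to the admissible exit of least rank. [folklore] -/
theorem trailStep_of {s : V × List V} (h : (n.oddExits z s).Nonempty) :
    n.trailStep rank z s =
      (Function.argminOn (rank s.1) (↑(n.oddExits z s) : Set V) h, s.1 :: s.2) := by
  unfold trailStep; rw [dif_pos h]

/-- The chosen exit is admissible. [folklore] -/
theorem argminOn_mem_oddExits {s : V × List V} (h : (n.oddExits z s).Nonempty) :
    Function.argminOn (rank s.1) (↑(n.oddExits z s) : Set V) h ∈ n.oddExits z s :=
  Finset.mem_coe.1 (Function.argminOn_mem _ _ h)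

/-- No admissible exit has smaller rank than the chosen one (the splitting rule). [folklore] -/
theorem rank_argminOn_le {s : V × List V} {w : V} (hw : w ∈ n.oddExits z s) :
    rank s.1 (Function.argminOn (rank s.1) (↑(n.oddExits z s) : Set V) ⟨w, hw⟩) ≤ rank s.1 w :=
  Function.argminOn_le (rank s.1) _ (Finset.mem_coe.2 hw)

/-- Unfolding of `trailRun` at `0`. [folklore] -/
@[simp] theorem trailRun_zero : n.trailRun rank a z 0 = (a, []) := rfl

/-- Unfolding of `trailRun` at a successor. [folklore] -/
theorem trailRun_succ (k : ℕ) :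
    n.trailRun rank a z (k + 1) = n.trailStep rank z (n.trailRun rank a z k) := by
  simp only [trailRun, Function.iterate_succ_apply']

/-- **Induction along the exploration**: a property of states holding initially and preserved by
every admissible move holds throughout. [folklore] -/
theorem trailRun_induction {P : V × List V → Prop} (h0 : P (a, []))
    (hstep : ∀ s, P s → ∀ w ∈ n.oddExits z s, P (w, s.1 :: s.2)) (k : ℕ) :
    P (n.trailRun rank a z k) := by
  induction k with
  | zero => exact h0
  | succ k ih =>
    rw [trailRun_succ]
    by_cases h : (n.oddExits z (n.trailRun rank a z k)).Nonempty
    · rw [trailStep_of h]; exact hstep _ ih _ (argminOn_mem_oddExits h)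
    · rwa [trailStep_of_not h]

/-- **The exploration only uses bonds of odd current.** [folklore] -/
theorem odd_bond_of_mem_trailEdges_trailRun (k : ℕ) :
    ∀ e ∈ trailEdges (n.trailRun rank a z k).1 (n.trailRun rank a z k).2, Odd (n.bond e) := by
  refine trailRun_induction (P := fun s => ∀ e ∈ trailEdges s.1 s.2, Odd (n.bond e)) ?_ ?_ k
  · simp
  · rintro ⟨p, l⟩ hP w hw e he
    simp only [trailEdges_cons, mem_insert] at he
    rcases he with rfl | he
    · rw [Sym2.eq_swap]; exact (mem_oddExits.1 hw).2.1
    · exact hP e he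

/-- **The bonds of the exploration are pairwise distinct**: the number of used bonds equals the
number of steps taken. [folklore] -/
theorem card_trailEdges_trailRun (k : ℕ) :
    #(trailEdges (n.trailRun rank a z k).1 (n.trailRun rank a z k).2) =
      (n.trailRun rank a z k).2.length := by
  refine trailRun_induction (P := fun s => #(trailEdges s.1 s.2) = s.2.length) ?_ ?_ k
  · simp
  · rintro ⟨p, l⟩ hP w hw
    have hnot : s(w, p) ∉ trailEdges p l := by rw [Sym2.eq_swap]; exact (mem_oddExits.1 hw).2.2
    simp only [trailEdges_cons, List.length_cons]
    rw [card_insert_of_notMem hnot]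
    exact congrArg (· + 1) hP

/-- **The exploration starts at `a`**: the earliest vertex of every state is `a`. [folklore] -/
theorem getLast_trailRun (k : ℕ) :
    ((n.trailRun rank a z k).1 :: (n.trailRun rank a z k).2).getLast (List.cons_ne_nil _ _) = a := by
  refine trailRun_induction
    (P := fun s => (s.1 :: s.2).getLast (List.cons_ne_nil _ _) = a) ?_ ?_ k
  · simp
  · rintro ⟨p, l⟩ hP w _
    simpa [List.getLast_cons (List.cons_ne_nil p l)] using hP

/-- **Consecutive vertices of the exploration are joined by bonds of odd current.** [folklore] -/
theorem isChain_trailRun (k : ℕ) :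
    List.IsChain (fun x y => Odd (n.bond s(x, y)))
      ((n.trailRun rank a z k).1 :: (n.trailRun rank a z k).2) := by
  refine trailRun_induction
    (P := fun s => List.IsChain (fun x y => Odd (n.bond s(x, y))) (s.1 :: s.2)) ?_ ?_ k
  · exact .singleton _
  · rintro ⟨p, l⟩ hP w hw
    refine .cons_cons ?_ hP
    rw [Sym2.eq_swap]
    exact (mem_oddExits.1 hw).2.1

/-- **Trail parity**: at every state, every vertex `v` lies on an even number of used bonds, up to
the corrections `+1` at the start `a` and `+1` at the current position (which cancel when they
coincide). [folklore] -/
theorem trailRun_parity (k : ℕ) (v : V) :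
    (#((trailEdges (n.trailRun rank a z k).1 (n.trailRun rank a z k).2).filter fun e => v ∈ e) +
        (if v = a then 1 else 0) + (if v = (n.trailRun rank a z k).1 then 1 else 0)) % 2 = 0 := by
  revert v
  refine trailRun_induction
    (P := fun s => ∀ v, (#((trailEdges s.1 s.2).filter fun e => v ∈ e) +
      (if v = a then 1 else 0) + (if v = s.1 then 1 else 0)) % 2 = 0) ?_ ?_ k
  · intro v
    by_cases hv : v = a
    · simp [hv]
    · simp [hv]
  · rintro ⟨p, l⟩ hP w hw v
    have ih := hP v
    have hpw : p ≠ w := ne_of_mem_oddExits hw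
    have hnot : s(w, p) ∉ trailEdges p l := by rw [Sym2.eq_swap]; exact (mem_oddExits.1 hw).2.2
    simp only [trailEdges_cons] at ih ⊢
    rw [Finset.filter_insert]
    by_cases hve : v ∈ s(w, p)
    · rw [if_pos hve, card_insert_of_notMem (fun h => hnot (Finset.mem_filter.1 h).1)]
      rcases Sym2.mem_iff.1 hve with rfl | rfl
      · have hvp : v ≠ p := fun h => hpw h.symm
        rw [if_neg hvp] at ih
        rw [if_pos rfl]
        omega
      · rw [if_pos rfl] at ih
        rw [if_neg hpw]
        omega
    · rw [if_neg hve]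
      have hvw : v ≠ w := fun h => hve (h ▸ Sym2.mem_mk_left v p)
      have hvp : v ≠ p := fun h => hve (h ▸ Sym2.mem_mk_right w v)
      rw [if_neg hvp] at ih
      rw [if_neg hvw]
      omega

/-- While the exploration is live it has moved at every step. [folklore] -/
theorem length_trailRun_of_nonempty (k : ℕ) (h : (n.oddExits z (n.trailRun rank a z k)).Nonempty) :
    (n.trailRun rank a z k).2.length = k := by
  induction k with
  | zero => rfl
  | succ k ih =>
    rw [trailRun_succ] at h ⊢
    by_cases hk : (n.oddExits z (n.trailRun rank a z k)).Nonempty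
    · rw [trailStep_of hk] at h ⊢
      simp only [List.length_cons, ih hk]
    · rw [trailStep_of_not hk] at h
      exact absurd h hk

/-- The used bonds of the exploration are edges of `G`. [folklore] -/
theorem trailEdges_trailRun_subset (k : ℕ) :
    trailEdges (n.trailRun rank a z k).1 (n.trailRun rank a z k).2 ⊆ G.edgeFinset := fun e he =>
  n.mem_edgeFinset_of_bond_ne_zero fun h0 => by
    have := odd_bond_of_mem_trailEdges_trailRun k e he
    simp [h0] at this

/-- **The exploration halts**: after `|E| + 1` steps no admissible exit is left (each productive
step uses a new bond of `G`). [folklore] -/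
theorem not_nonempty_oddExits_backboneState :
    ¬(n.oddExits z (n.backboneState rank a z)).Nonempty := by
  intro h
  have hlen := length_trailRun_of_nonempty (rank := rank) (n := n) (a := a) (z := z) _ h
  have hcard := card_trailEdges_trailRun (rank := rank) (n := n) (a := a) (z := z)
    (#G.edgeFinset + 1)
  have hle := Finset.card_le_card
    (trailEdges_trailRun_subset (rank := rank) (n := n) (a := a) (z := z) (#G.edgeFinset + 1))
  omega

/-- At the final state, either the target is reached or every bond of odd current at the position
has been used. [folklore] -/
theorem mem_trailEdges_of_backboneEnd_ne (hz : n.backboneEnd rank a z ≠ z) {w : V}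
    (hw : Odd (n.bond s(n.backboneEnd rank a z, w))) :
    s(n.backboneEnd rank a z, w) ∈
      trailEdges (n.backboneState rank a z).1 (n.backboneState rank a z).2 := by
  by_contra hnot
  exact not_nonempty_oddExits_backboneState ⟨w, mem_oddExits.2 ⟨hz, hw, hnot⟩⟩

/-- **Aizenman's observation** (1982, §9, p. 23: "if `∂n = {x, y}` then any nonrepeating path
along bonds with odd values of `n` which starts at `x`, eventually reaches `y`"): for a current
with sources `{a} ∆ {z}` the canonical backbone from `a` ends at `z`. No hypothesis on the ranking
is needed. [cite: AizenmanCMP1982, §9 p. 23] -/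
theorem backboneEnd_eq_of_sources_eq (hn : n.sources = {a} ∆ {z}) : n.backboneEnd rank a z = z := by
  by_contra hz
  set p := n.backboneEnd rank a z with hp
  have hEq : (trailEdges (n.backboneState rank a z).1 (n.backboneState rank a z).2).filter
      (fun e => p ∈ e) = n.oddBondsAt p := by
    ext e
    simp only [mem_filter, oddBondsAt, mem_univ, true_and]
    constructor
    · rintro ⟨he, hpe⟩
      exact ⟨hpe, odd_bond_of_mem_trailEdges_trailRun _ e he⟩
    · rintro ⟨hpe, hodd⟩
      obtain ⟨w, rfl⟩ := Sym2.mem_iff_exists.1 hpe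
      exact ⟨mem_trailEdges_of_backboneEnd_ne hz hodd, hpe⟩
  have hpar := trailRun_parity (rank := rank) (n := n) (a := a) (z := z) (#G.edgeFinset + 1) p
  have hpos : (n.trailRun rank a z (#G.edgeFinset + 1)).1 = p := rfl
  rw [hpos, if_pos rfl] at hpar
  change (#((trailEdges (n.backboneState rank a z).1 (n.backboneState rank a z).2).filter
    fun e => p ∈ e) + (if p = a then 1 else 0) + 1) % 2 = 0 at hpar
  rw [hEq] at hpar
  by_cases hpa : p = a
  · rw [if_pos hpa] at hpar
    have hnot : p ∉ n.sources := by
      rw [mem_sources_iff_odd_card_oddBondsAt, Nat.odd_iff]; omega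
    rw [hn, hpa, Finset.mem_symmDiff] at hnot
    simp only [mem_singleton, true_and, not_true, and_false, or_false, not_not] at hnot
    exact hz (hpa.trans hnot)
  · rw [if_neg hpa] at hpar
    have hmem : p ∈ n.sources := by
      rw [mem_sources_iff_odd_card_oddBondsAt, Nat.odd_iff]; omega
    rw [hn, Finset.mem_symmDiff] at hmem
    simp only [mem_singleton] at hmem
    tauto

/-- With target equal to the start the exploration never moves. [folklore] -/
theorem trailRun_self (k : ℕ) : n.trailRun rank a a k = (a, []) := by
  induction k with
  | zero => rfl
  | succ k ih => rw [trailRun_succ, ih, trailStep_of_not (by simp [oddExits_of_eq])]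

/-- The backbone from `a` towards `a` is the one-point path `[a]`. [folklore] -/
@[simp] theorem backbone_self : n.backbone rank a a = [a] := by
  simp [backbone, backboneState, trailRun_self]

/-- The zero current is never explored. [folklore] -/
theorem trailRun_zero_current (k : ℕ) : (0 : Current G).trailRun rank a z k = (a, []) := by
  induction k with
  | zero => rfl
  | succ k ih => rw [trailRun_succ, ih, trailStep_of_not (by simp)]

/-- The backbone of the zero current is the one-point path `[a]`. [folklore] -/
@[simp] theorem backbone_zero_current : (0 : Current G).backbone rank a z = [a] := by
  simp [backbone, backboneState, trailRun_zero_current]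

/-- The backbone is a non-empty list. [folklore] -/
theorem backbone_ne_nil : n.backbone rank a z ≠ [] := by simp [backbone]

/-- **The backbone starts at `a`.** [folklore] -/
theorem head?_backbone : (n.backbone rank a z).head? = some a := by
  rw [backbone, List.head?_reverse, List.getLast?_eq_some_getLast (List.cons_ne_nil _ _)]
  exact congrArg some (getLast_trailRun _)

/-- The backbone ends at `backboneEnd`. [folklore] -/
theorem getLast_backbone :
    (n.backbone rank a z).getLast backbone_ne_nil = n.backboneEnd rank a z := by
  simp [backbone, backboneEnd]

/-- **The backbone ends at `z`** when `∂n = {a} ∆ {z}`. [cite: AizenmanCMP1982, §9 p. 23] -/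
theorem getLast_backbone_eq_of_sources_eq (hn : n.sources = {a} ∆ {z}) :
    (n.backbone rank a z).getLast backbone_ne_nil = z := by
  rw [getLast_backbone, backboneEnd_eq_of_sources_eq hn]

/-- **Consecutive vertices of the backbone are joined by bonds of odd current.** [folklore] -/
theorem isChain_backbone :
    List.IsChain (fun x y => Odd (n.bond s(x, y))) (n.backbone rank a z) := by
  rw [backbone, List.isChain_reverse]
  exact (isChain_trailRun _).imp fun x y h => by
    show Odd (n.bond s(y, x))
    rwa [Sym2.eq_swap]

/-- In particular the backbone is a walk in `G`. [folklore] -/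
theorem isChain_adj_backbone : List.IsChain G.Adj (n.backbone rank a z) :=
  isChain_backbone.imp fun _ _ h => n.adj_of_bond_ne_zero fun h0 => by simp [h0] at h

/-- The bonds of the backbone are pairwise distinct (it is a trail): their number is the number of
steps. [folklore] -/
theorem card_trailEdges_backboneState :
    #(trailEdges (n.backboneState rank a z).1 (n.backboneState rank a z).2) =
      (n.backbone rank a z).length - 1 := by
  simp [backbone, backboneState, card_trailEdges_trailRun]

end BackboneProofs

end Current

/-! ### Lattice directions and the local splitting rule -/

section Lattice

variable {d : ℕ}

/-- The unit lattice vector of the direction `(i, s)`: `+eᵢ` if `s = true`, `-eᵢ` otherwise. [folklore] -/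
def unitVec (p : Fin d × Bool) : Site d := Pi.single p.1 (cond p.2 1 (-1))

/-- The fixed code of a lattice direction, `+eᵢ ↦ 2i`, `-eᵢ ↦ 2i + 1` (so the directions are
ordered `+e₀ < -e₀ < +e₁ < -e₁ < …`); vectors that are not unit lattice vectors get the junk code
`0`. This total order of the `2d` directions is the local splitting rule of the canonical
backbone on `ℤ^d`. [folklore] -/
def dirCode (u : Site d) : ℕ :=
  (univ.filter fun p : Fin d × Bool => u = unitVec p).sup fun p => 2 * (p.1 : ℕ) + cond p.2 0 1

/-- The local ranking of the neighbours of `x` induced by a position map `pos : V → ℤ^d`: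
`y` is ranked by the direction code of `pos y - pos x` (translation invariant). [folklore] -/
def latticeRank (pos : V → Site d) (x y : V) : ℕ := dirCode (pos y - pos x)

omit [Fintype V] [DecidableRel G.Adj] in
/-- The ranking is invariant under translating the drawing. [folklore] -/
theorem latticeRank_add_const (pos : V → Site d) (v : Site d) :
    latticeRank (fun x => pos x + v) = latticeRank pos := by
  funext x y
  simp [latticeRank, add_sub_add_right_eq_sub]

/-- The word of steps (increments) of a list of lattice points. [folklore] -/
def steps : List (Site d) → List (Site d)
  | [] => []
  | [_] => []
  | x :: y :: l => (y - x) :: steps (y :: l)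

/-- A list of `k + 1` points has `k` steps. [folklore] -/
theorem length_steps : ∀ l : List (Site d), (steps l).length = l.length - 1
  | [] => rfl
  | [_] => rfl
  | _ :: y :: l => by
    rw [steps, List.length_cons, length_steps (y :: l)]
    simp

end Lattice

/-! ### Spin-½ holonomy of a lattice word in `ℤ³` -/

section Holonomy

open Literature.MathematicalPhysics.QuantumLattice (spinHalfPauli)

/-- The Pauli vector `u · σ = u₀ σˣ + u₁ σʸ + u₂ σᶻ` of an integer vector `u`
(Tasaki 2020, §2.1, eq. (2.1.8)). [cite: Tasaki2020, §2.1 eq. (2.1.8)] -/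
def pauliVec (u : Fin 3 → ℤ) : Matrix (Fin 2) (Fin 2) ℂ :=
  ∑ k : Fin 3, ((u k : ℤ) : ℂ) • spinHalfPauli k

/-- The spin-½ lift `h(u, v)` of the minimal rotation taking the lattice direction `u` to the
lattice direction `v`: for perpendicular `u`, `v` (unit lattice vectors) the rotation by `π/2`
about the unit vector `u × v`, lifted to `exp(-i (π/4) (u × v)·σ) = (1/√2)(1 - i (u × v)·σ)`
(the spin-½ rotation operator, Tasaki 2020, §2.1, eq. (2.1.10), in closed form); the identity
when `v = u`, and by convention also for the reversal `v = -u` (which never occurs along a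
trail). Meaningful on unit lattice vectors. [cite: Tasaki2020, §2.1 eq. (2.1.10)] -/
def spinTurn (u v : Fin 3 → ℤ) : Matrix (Fin 2) (Fin 2) ℂ :=
  if u ⬝ᵥ v = 0 then ((Real.sqrt 2 : ℝ) : ℂ)⁻¹ • (1 - Complex.I • pauliVec (u ⨯₃ v)) else 1

/-- The holonomy of a word of lattice steps `[d₀, d₁, …, d_m]`: the ordered product
`h(d₀, d₁) h(d₁, d₂) ⋯ h(d_{m-1}, d_m)` of the turn factors of consecutive steps (first turn
leftmost); words with fewer than two steps have holonomy `1`. [folklore] -/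
def holonomy : List (Fin 3 → ℤ) → Matrix (Fin 2) (Fin 2) ℂ
  | [] => 1
  | [_] => 1
  | u :: v :: w => spinTurn u v * holonomy (v :: w)

/-- Unfolding of `holonomy` on the empty word. [folklore] -/
@[simp] theorem holonomy_nil : holonomy [] = 1 := rfl

/-- Unfolding of `holonomy` on a one-step word. [folklore] -/
@[simp] theorem holonomy_singleton (u : Fin 3 → ℤ) : holonomy [u] = 1 := rfl

/-- Unfolding of `holonomy`: the first turn factor times the holonomy of the tail. [folklore] -/
theorem holonomy_cons_cons (u v : Fin 3 → ℤ) (w : List (Fin 3 → ℤ)) :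
    holonomy (u :: v :: w) = spinTurn u v * holonomy (v :: w) := rfl

/-- Going straight costs nothing: `h(u, u) = 1` for `u ≠ 0`. [folklore] -/
theorem spinTurn_self {u : Fin 3 → ℤ} (hu : u ≠ 0) : spinTurn u u = 1 := by
  unfold spinTurn
  rw [if_neg]
  exact fun h => hu (dotProduct_self_eq_zero.1 h)

/-- The turn factor of perpendicular directions, unfolded. [folklore] -/
theorem spinTurn_of_dotProduct_eq_zero {u v : Fin 3 → ℤ} (h : u ⬝ᵥ v = 0) :
    spinTurn u v = ((Real.sqrt 2 : ℝ) : ℂ)⁻¹ • (1 - Complex.I • pauliVec (u ⨯₃ v)) := by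
  unfold spinTurn; rw [if_pos h]

/-- The Pauli vector as an explicit matrix `!![u₂, u₀ - i u₁; u₀ + i u₁, -u₂]`
(Tasaki 2020, §2.1, eq. (2.1.8)). [cite: Tasaki2020, §2.1 eq. (2.1.8)] -/
theorem pauliVec_eq (w : Fin 3 → ℤ) : pauliVec w =
    !![((w 2 : ℤ) : ℂ), ((w 0 : ℤ) : ℂ) - ((w 1 : ℤ) : ℂ) * Complex.I;
       ((w 0 : ℤ) : ℂ) + ((w 1 : ℤ) : ℂ) * Complex.I, -((w 2 : ℤ) : ℂ)] := by
  ext i j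
  (fin_cases i <;> fin_cases j <;>
    simp [pauliVec, Literature.MathematicalPhysics.QuantumLattice.spinHalfPauli,
      Fin.sum_univ_three, smul_eq_mul]); ring

/-- The Pauli algebra: `(w·σ)² = |w|² · 1`. [cite: Tasaki2020, §2.1 eq. (2.1.9)] -/
theorem pauliVec_mul_self (w : Fin 3 → ℤ) :
    pauliVec w * pauliVec w = ((w ⬝ᵥ w : ℤ) : ℂ) • (1 : Matrix (Fin 2) (Fin 2) ℂ) := by
  rw [pauliVec_eq]
  ext i j
  fin_cases i <;> fin_cases j <;>
    simp [Matrix.mul_apply, Fin.sum_univ_two, dotProduct, Fin.sum_univ_three] <;> ring_nf <;>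
    simp [Complex.I_sq]

/-- The Pauli vector of an integer vector is Hermitian. [folklore] -/
theorem conjTranspose_pauliVec (w : Fin 3 → ℤ) : (pauliVec w)ᴴ = pauliVec w := by
  rw [pauliVec_eq]
  ext i j
  (fin_cases i <;> fin_cases j <;> simp [Matrix.conjTranspose_apply]); ring

/-- **Unitarity of the turn factor**: if `u ⊥ v` and `u × v` is a unit vector then
`h(u,v) h(u,v)ᴴ = 1` (`(1/√2)² (1 - i n·σ)(1 + i n·σ) = ½ (1 + (n·σ)²) = 1`). [folklore] -/
theorem spinTurn_mul_conjTranspose {u v : Fin 3 → ℤ} (h : u ⬝ᵥ v = 0)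
    (hw : (u ⨯₃ v) ⬝ᵥ (u ⨯₃ v) = 1) :
    spinTurn u v * (spinTurn u v)ᴴ = 1 := by
  rw [spinTurn_of_dotProduct_eq_zero h]
  set P := pauliVec (u ⨯₃ v) with hPdef
  set c : ℂ := ((Real.sqrt 2 : ℝ) : ℂ)⁻¹ with hcdef
  have hP : Pᴴ = P := conjTranspose_pauliVec _
  have hPP : P * P = 1 := by rw [hPdef, pauliVec_mul_self, hw]; simp
  have hc : c * c * 2 = 1 := by
    rw [hcdef, ← mul_inv, ← Complex.ofReal_mul, Real.mul_self_sqrt (by norm_num : (0:ℝ) ≤ 2)]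
    push_cast
    norm_num
  have hsc : star c = c := by
    rw [hcdef, Complex.star_def, map_inv₀, Complex.conj_ofReal]
  have key : ((1 : Matrix (Fin 2) (Fin 2) ℂ) - Complex.I • P) * (1 + Complex.I • P) = 1 + 1 := by
    rw [sub_mul, one_mul, mul_add, mul_one, Matrix.smul_mul, Matrix.mul_smul, smul_smul, hPP,
      Complex.I_mul_I, neg_smul, one_smul]
    abel
  rw [Matrix.conjTranspose_smul, Matrix.conjTranspose_sub, Matrix.conjTranspose_one,
    Matrix.conjTranspose_smul, hP, hsc, Complex.star_def, Complex.conj_I, neg_smul, sub_neg_eq_add,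
    Matrix.smul_mul, Matrix.mul_smul, smul_smul, key, ← two_smul ℂ, smul_smul, hc, one_smul]

/-- Hence the turn factor is unitary under the same hypotheses. [folklore] -/
theorem spinTurn_mem_unitaryGroup {u v : Fin 3 → ℤ} (h : u ⬝ᵥ v = 0)
    (hw : (u ⨯₃ v) ⬝ᵥ (u ⨯₃ v) = 1) : spinTurn u v ∈ Matrix.unitaryGroup (Fin 2) ℂ := by
  rw [Matrix.mem_unitaryGroup_iff, Matrix.star_eq_conjTranspose]
  exact spinTurn_mul_conjTranspose h hw

/-- For perpendicular unit vectors `u ⊥ v` the axis `u × v` is a unit vector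
(`|u × v|² = |u|²|v|² - (u·v)²`). [folklore] -/
theorem cross_dotProduct_cross_self {u v : Fin 3 → ℤ} (hu : u ⬝ᵥ u = 1) (hv : v ⬝ᵥ v = 1)
    (h : u ⬝ᵥ v = 0) : (u ⨯₃ v) ⬝ᵥ (u ⨯₃ v) = 1 := by
  rw [cross_dot_cross, hu, hv, h, zero_mul, sub_zero, mul_one]

/-- **The turn factor of two perpendicular unit lattice directions is unitary** (it lies in the
binary octahedral subgroup of `SU(2)`; only unitarity is recorded here). [folklore] -/
theorem spinTurn_mem_unitaryGroup_of_perp {u v : Fin 3 → ℤ} (hu : u ⬝ᵥ u = 1) (hv : v ⬝ᵥ v = 1)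
    (h : u ⬝ᵥ v = 0) : spinTurn u v ∈ Matrix.unitaryGroup (Fin 2) ℂ :=
  spinTurn_mem_unitaryGroup h (cross_dotProduct_cross_self hu hv h)

/-- A straight word has trivial holonomy. [folklore] -/
theorem holonomy_replicate {u : Fin 3 → ℤ} (hu : u ≠ 0) : ∀ k : ℕ, holonomy (List.replicate k u) = 1
  | 0 => rfl
  | 1 => rfl
  | k + 2 => by
    rw [show List.replicate (k + 2) u = u :: u :: List.replicate k u from rfl, holonomy_cons_cons,
      spinTurn_self hu, one_mul]
    exact holonomy_replicate hu (k + 1)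

end Holonomy

/-! ### The decorated observable -/

section Observable

variable (G)
variable [DecidableEq V]

/-- The high-temperature generating sum of currents with prescribed sources,
`∑_{n : ∂n = A} t^{|n|}`, as a `tsum` over all currents (absolutely convergent for `|t| < 1`,
`summable_currentSizeSum_term`). [folklore] -/
def currentSizeSum (t : ℝ) (A : Finset V) : ℝ :=
  ∑' n : Current G, if n.sources = A then t ^ n.size else 0

variable {G} in
/-- The holonomy `Hol(γ(n))` of the canonical backbone of `n` from `a` towards `z`, for a graph
drawn in `ℤ³` by the position map `pos` (splitting rule `latticeRank pos`). [folklore] -/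
def Current.hol (pos : V → Site 3) (n : Current G) (a z : V) : Matrix (Fin 2) (Fin 2) ℂ :=
  holonomy (steps ((n.backbone (latticeRank pos) a z).map pos))

variable {G} in
/-- The zero current has trivial holonomy. [folklore] -/
@[simp] theorem Current.hol_zero_current (pos : V → Site 3) (a z : V) :
    (0 : Current G).hol pos a z = 1 := by
  simp [Current.hol, steps]

variable {G} in
/-- With probe equal to the source the holonomy is trivial. [folklore] -/
@[simp] theorem Current.hol_self (pos : V → Site 3) (n : Current G) (a : V) : n.hol pos a a = 1 := by
  simp [Current.hol, steps]

/-- The decorated current sum `∑_{n : ∂n = {a} ∆ {z}} t^{|n|} Hol(γ(n)) ∈ M₂(ℂ)`. [folklore] -/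
def decoratedCurrentSum (pos : V → Site 3) (t : ℝ) (a z : V) : Matrix (Fin 2) (Fin 2) ℂ :=
  ∑' n : Current G, if n.sources = {a} ∆ {z} then ((t : ℂ) ^ n.size) • n.hol pos a z else 0

/-- **The `SU(2)`-decorated random-current two-point observable** (posited object of route
`DiracCensus`, notion `DecoratedCurrentObservable`):
`F_t(a; z) = (∑_{∂n = ∅} t^{|n|})⁻¹ ∑_{∂n = {a} ∆ {z}} t^{|n|} Hol(γ(n)) ∈ M₂(ℂ)`, for a finite
graph `G` drawn in `ℤ³` by `pos`, parameter `t` (`= tanh β`), source `a` and probe `z`. The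
planar version with `U(1)` winding phases in place of `Hol` is the spin fermionic observable of
Smirnov and Chelkak–Smirnov. [folklore] -/
def decoratedCurrentObservable (pos : V → Site 3) (t : ℝ) (a z : V) : Matrix (Fin 2) (Fin 2) ℂ :=
  ((currentSizeSum G t ∅ : ℝ) : ℂ)⁻¹ • decoratedCurrentSum G pos t a z

/-- Bounded partial sums: `∑_{n ∈ S} t^{|n|} ≤ (1 - t)^{-|E|}` for `0 ≤ t < 1` (the boxes
`{n | n_e < N}` give products of partial geometric sums). [folklore] -/
theorem sum_pow_size_le {t : ℝ} (ht0 : 0 ≤ t) (ht1 : t < 1) (S : Finset (Current G)) :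
    ∑ n ∈ S, t ^ n.size ≤ ((1 - t)⁻¹) ^ #G.edgeFinset := by
  classical
  set N := S.sup (fun n => univ.sup n) + 1 with hN
  have hS : S ⊆ Fintype.piFinset fun _ : G.edgeFinset => range N := by
    intro n hn
    rw [Fintype.mem_piFinset]
    intro e
    rw [mem_range]
    have h1 : n e ≤ univ.sup n := Finset.le_sup (f := n) (mem_univ e)
    have h2 : univ.sup n ≤ S.sup (fun n => univ.sup n) :=
      Finset.le_sup (f := fun n : Current G => univ.sup n) hn
    omega
  have hgeom : ∀ M : ℕ, ∑ k ∈ range M, t ^ k ≤ (1 - t)⁻¹ := fun M => by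
    rw [← tsum_geometric_of_lt_one ht0 ht1]
    exact (summable_geometric_of_lt_one ht0 ht1).sum_le_tsum (range M) fun k _ => pow_nonneg ht0 k
  calc ∑ n ∈ S, t ^ n.size
      ≤ ∑ n ∈ Fintype.piFinset (fun _ : G.edgeFinset => range N), t ^ Current.size n :=
        Finset.sum_le_sum_of_subset_of_nonneg hS fun n _ _ => pow_nonneg ht0 _
    _ = ∏ _e : G.edgeFinset, ∑ k ∈ range N, t ^ k := by
        rw [Finset.prod_univ_sum]
        exact Finset.sum_congr rfl fun n _ => Current.pow_size t n
    _ ≤ ∏ _e : G.edgeFinset, (1 - t)⁻¹ :=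
        Finset.prod_le_prod (fun e _ => Finset.sum_nonneg fun k _ => pow_nonneg ht0 k)
          fun e _ => hgeom N
    _ = ((1 - t)⁻¹) ^ #G.edgeFinset := by
        rw [Finset.prod_const, Finset.card_univ, Fintype.card_coe]

/-- The weights `|t|^{|n|}` are summable over all currents for `|t| < 1`. [folklore] -/
theorem summable_pow_size {t : ℝ} (ht : |t| < 1) : Summable fun n : Current G => t ^ n.size := by
  have h : Summable fun n : Current G => |t| ^ n.size :=
    summable_of_sum_le (fun n => pow_nonneg (abs_nonneg t) _)
      (sum_pow_size_le G (abs_nonneg t) ht)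
  refine h.of_norm_bounded fun n => ?_
  rw [norm_pow, Real.norm_eq_abs]

/-- The terms of `currentSizeSum` are summable for `|t| < 1`. [folklore] -/
theorem summable_currentSizeSum_term {t : ℝ} (ht : |t| < 1) (A : Finset V) :
    Summable fun n : Current G => if n.sources = A then t ^ n.size else 0 := by
  have h : Summable fun n : Current G => |t| ^ n.size := by
    have := summable_pow_size G (t := |t|) (by rwa [abs_abs])
    exact this
  refine h.of_norm_bounded fun n => ?_
  split_ifs
  · rw [norm_pow, Real.norm_eq_abs]
  · rw [norm_zero]; exact pow_nonneg (abs_nonneg t) _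

/-- **The normaliser is positive**: `∑_{∂n = ∅} t^{|n|} > 0` for `0 ≤ t < 1` (the zero current
contributes `1`, all terms are non-negative), so `decoratedCurrentObservable` is not a junk value
there. [folklore] -/
theorem currentSizeSum_empty_pos {t : ℝ} (ht0 : 0 ≤ t) (ht1 : t < 1) : 0 < currentSizeSum G t ∅ := by
  unfold currentSizeSum
  have ht : |t| < 1 := by rwa [abs_of_nonneg ht0]
  refine (summable_currentSizeSum_term G ht ∅).tsum_pos (fun n => ?_) 0 (by simp)
  split_ifs
  · exact pow_nonneg ht0 _
  · exact le_rfl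

/-- For `0 ≤ t < 1` the normaliser is at least the contribution `1` of the zero current. [folklore] -/
theorem one_le_currentSizeSum_empty {t : ℝ} (ht0 : 0 ≤ t) (ht1 : t < 1) :
    1 ≤ currentSizeSum G t ∅ := by
  unfold currentSizeSum
  have ht : |t| < 1 := by rwa [abs_of_nonneg ht0]
  have h := (summable_currentSizeSum_term G ht ∅).sum_le_tsum {0} fun n _ => by
    split_ifs
    · exact pow_nonneg ht0 _
    · exact le_rfl
  simpa using h

end Observable

end Literature.Probability.LatticeModels

end
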